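import Summits.QuantumFields.BalabanUV.T4Continuum.Support.NE7ApeOfTorusRoadV3
import Summits.QuantumFields.BalabanUV.T4Continuum.Support.NE7ApeFlatSkeletonTestClass
import Summits.QuantumFields.BalabanUV.T4Continuum.Support.NE7SliceGreenFlatLocalisedStraight
import Summits.QuantumFields.BalabanUV.T4Continuum.Support.NE7FlatHkOrthogonalStraight
import HarnessLib

/-!
# NE7ApeOfTorusRoadV4 — THE TORUS ROAD v4 END: v3 (F257: split normal part, G♭-loc and (R7♭)-loc DISCHARGED) run on the STRAIGHT-TANGENT TEST CLASS — the
# two-region criticality defect is hypothesised only on skew periodic `Y` with `(Qcoarse L)^[k+1] Y = 0` (vanishing straight `(k+1)`-fold average), the class on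
# which the frame term of the top linearised average vanishes at ANY top (memo §7), and the far region is `{|⌊x∕M⌋ − blk z̄|_T ≥ ℓ}` (threshold `ℓ` itself)

Cell `pub-balaban`, rung (B)+1 sub-cell t4, lineage `b2b-balaban-t4-ne7-p1` (CRUX PROVER NE7 #1 = OWNER of row NE7), generation 89; memo
`t4/b2b-balaban-t4-ne7-p1-g89/COSTING-N1.md` §7.  File F263 (over F260 `NE7ApeFlatSkeletonTestClass.norm_plaq_sub_one_le_of_localisedLetters_gauge_test` (the bootstrap,
parametric in the test class), F261 `NE7SliceGreenFlatLocalisedStraight.sliceGreen_flat_localised_straight` (G♭-loc on straight tests), F262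
`NE7FlatHkOrthogonalStraight.hess_flat_hkLift_eq_zero_straight` ((R⊥♭) on straight tests), F256 `NE7FlatLiftSplitRow` ((R7♭)-loc in split form), F243
`smallField_floor_of_affineImprovement`, p2 `NE7FlatSkewSlice`, F44 `hkLift_periodic`, F48b EXP; F257's proof verbatim otherwise).

WHY (memo §7).  The defect supplier (N2) bounds `dAction_{e^A}(χ′Y)` by `c_R·‖Q̄(χ′Y)‖₁` after absorbing the frame by an exact gauge direction (F244, any top); the
straight average `Q̄_1` of a test direction kills that frame term iff the test is STRAIGHT-tangent — on flat tangents (`D_1Y = 0`, v3's class) it does not unless the top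
is flat.  The bootstrap is indifferent to the class (F260), (R⊥♭) holds on it (F262: entries in `ker Q_k`), and G♭-loc is EASIER on it (F261: no tangent corrector,
constant `4(card n)³(K_a + K_b)`, on `d, card n` only, `L ≥ 1`).
WHAT ([folklore] composition; 0 def, 0 sorry; dimension `d + 1`, `L ≥ 1`).
§1 **`exists_flat_normalPart_split_straight`** — F257 §1 with NORTH on straight tests: for `A` skew `(L^{k+1}N)`-periodic with `D_1A = φ₁ + E` (`φ₁` `N`-periodic,
   `‖curlAt 1 φ₁‖ ≤ ĝ`, `‖E(rep y,λ)‖ ≤ W(y)`): `∃ A_N` skew periodic EXACT, `hess 1 A_N Y = 0` for skew periodic `Y` with `(Qcoarse L)^[k+1] Y = 0`, and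
   `‖curlAt 1 A_N(z)‖ ≤ card n·[(C_LIN∕M)(ĝ∕M) + M⁻¹·2C_dec·Σ_y e^{−κ′|blk z̄ − y|_T}(d+1)(W(y)∕M)]` at every `z`.
§2 **`hape_of_torusRoadV4`** — `∃ K c ≥∕> 0` (on `d, card n`) such that hape ⇐ per plaquette `∃ A φ₁ E α₀ α₁ τn τf ĝ s ℓ u`: chart letters + the split `D_1A = φ₁ + E`;
   the two-region defect ON STRAIGHT-TANGENT TESTS with regions `{|⌊x∕M⌋ − blk z̄|_T < ℓ}` ∕ `{≥ ℓ}`; the gauge matching; the line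
   `K·M·((τn + ρ) + e^{−cℓ}(τf + ρ)) + card n·[(C_LIN∕M)(ĝ∕M) + C_far·e^{−κ′ℓ∕2}·s∕M²] + 28α₀² ≤ (c₀ + θr)∕M²`.
HONEST FRAMING (page 1): composition BY NAME of tree theorems; the per-plaquette bundle is a HYPOTHESIS asserted for nothing — its suppliers (N1)-weak ([B8] Thm 2 TYPE at
`U₀ = 1`, local; INTERFACE REQUEST NE7 of [NE7P1-G89-INBOX-1]), (N2) the two-region defect assembly on straight tests, (N3)″ the near coarse-curl bound `ĝ` and the
commutator size `s` are NOT in the tree; nothing of Bałaban's asserted; NOT (APE), NOT ONE-STEP, NOT NE7; spine 0∕9; finite T⁴ rung (B)+1 — NOT infinite volume, NOT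
mass gap, NOT `BetaPertH`, NOT Clay.  Continuum YM on T⁴ ⇐ BetaPertH ∧ nine spine estimates (0/9 proved); BetaPertH ⇐ (D1) ∧ (D4) ∧ CAP+tail; G-an2-4 gates asym, D1
and NE2/3/4.
-/

set_option autoImplicit false

open scoped BigOperators Matrix.Norms.L2Operator
open NormedSpace Finset Set

namespace Summit.QuantumFields.BalabanUV.T4Continuum.NE7ApeOfTorusRoadV4

open Literature.MathematicalPhysics.QuantumFieldTheory.Balaban1983to89
open B7Prop1Explicit B7Prop2Explicit MatrixLog UnitaryModel
open T4AveragingDeficitWall (IsUnitaryCfg IsSkewDir SmallField vary curlAt dirL1 flat_mem_classes)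
open T4AveragingDeficitWallBoundary (IsPeriodicCfg periodBox)
open AveragingDeficitPeriodicCounting (IsPeriodicDir)
open AveragingDeficitMultiLevelPrep (LevelSmall TangentIter tower)
open AveragingDeficitMultiLevelBridge (tower_eq)
open MinimalActionLevels (perWin)
open MinimalActionSandwich (admissible)
open MinimalActionRate (sfClass)
open BlockAveragePushDirSplit (flat)
open BlockAverageVaryHolo (nbRad)
open B4Sect5Proof (latticeConst latticeConst_nonneg)
open B4TorusKernel.MultiPeriod (torusSupNorm)
open B5Prop11Plancherel (Tor fine)
open B5Blocks16 (blockOf)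
open B5Hk163Strip (kappa163 kappa163_pos)
open B5Hk163TorusHolderDecay (CdecD CdecD_nonneg)
open B6LowerBound2153Torus (toT rep)
open NE3HessForm (hess dAction)
open NE3TangentCovariantTower (dirIter)
open NE3EnergyShapes (IsUnitarySite)
open NE3CpushGaugeCovariance (dirIter_succ_eq_cpushIter)
open NE7FlatLiftBookkeeping (hkLift_periodic)
open NE7FlatSkewSlice (skewPart isSkewDir_skewPart isPeriodicDir_skewPart skewPart_eq_self dirIter_flat_skewPart isSkewDir_dirIter_flat
  hess_flat_skewPart norm_curlAt_flat_skewPart_le)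
open NE7FlatHkOrthogonalStraight (hess_flat_hkLift_eq_zero_straight)
open NE3TangentFlatStructure (Qcoarse)
open NE7ExpansionRemainderFlat (abs_dAction_vary_sub_hess_flat_le)
open NE7TangentTransportGauge (dirIter_skew_periodic)
open NE7CoarseCurvatureLetter (levelSmall_zero)
open NE7ApeOfLocalChartLetter (smallField_floor_of_affineImprovement)
open NE7ApeFlatSkeletonLocalised (dirL1_le_add_of_subset_union)
open NE7ApeFlatSkeletonTestClass (norm_plaq_sub_one_le_of_localisedLetters_gauge_test)
open NE7SliceGreenFlatLocalisedStraight (sliceGreen_flat_localised_straight)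
open NE7FlatLiftSplitRow (rightInverse_flat_curl_le_split sum_exp_far_weight_le)

noncomputable section

variable {d : ℕ} {n : Type*} [Fintype n] [DecidableEq n]

/-! ## §1 The split normal part, NORTH on straight-tangent tests -/

/-- **THE FLAT NORMAL PART WITH THE SPLIT CURL ROW, NORTH ON STRAIGHT-TANGENT TESTS** (dimension `d + 1`): for every skew `(L^{k+1}·N)`-periodic `A` whose linearised
top average splits as `D_1A = φ₁ + E` with `φ₁` `N`-periodic of flat curl `≤ ĝ` and `‖E(rep y, λ)‖ ≤ W(y)`, there is `A_N` skew, periodic, EXACT, Hessian-orthogonal to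
every skew periodic `Y` with `(Qcoarse L)^[k+1] Y = 0` (F262), with `‖curlAt 1 A_N(z)‖ ≤ card n·[(C_LIN∕M)(ĝ∕M) + M⁻¹·2C_dec·Σ_y e^{−κ′|blk z̄ − y|_T}(d+1)(W(y)∕M)]`
at EVERY `z` (F256 §2 + the skew part). [folklore] -/
theorem exists_flat_normalPart_split_straight [Nonempty n] {L : ℕ} (hL : 1 ≤ L) (k N : ℕ) [NeZero N] [NeZero (L ^ (k + 1))]
    {A : Site (d + 1) → Fin (d + 1) → Matrix n n ℂ} (hA : IsSkewDir A) (hAP : IsPeriodicDir A ((L ^ (k + 1) * N : ℕ) : ℤ))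
    (φ₁ E : Site (d + 1) → Fin (d + 1) → Matrix n n ℂ) (hsplit : dirIter L (k + 1) (flat (d := d + 1) (n := n)) A = φ₁ + E)
    (hφ₁P : IsPeriodicDir φ₁ (N : ℤ))
    {g : ℝ} (hg : ∀ (y : Site (d + 1)) (μ ν : Fin (d + 1)), ‖curlAt (flat (d := d + 1) (n := n)) φ₁ y μ ν‖ ≤ g)
    (W : Tor (fun _ : Fin (d + 1) => N) → ℝ) (hW : ∀ (y : Tor (fun _ : Fin (d + 1) => N)) (lam : Fin (d + 1)), ‖E (rep (fun _ : Fin (d + 1) => N) y) lam‖ ≤ W y) :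
    ∃ AN : Site (d + 1) → Fin (d + 1) → Matrix n n ℂ,
      IsSkewDir AN ∧ IsPeriodicDir AN ((L ^ (k + 1) * N : ℕ) : ℤ) ∧
      dirIter L (k + 1) (flat (d := d + 1) (n := n)) AN = dirIter L (k + 1) (flat (d := d + 1) (n := n)) A ∧
      (∀ Y : Site (d + 1) → Fin (d + 1) → Matrix n n ℂ, IsSkewDir Y → IsPeriodicDir Y ((L ^ (k + 1) * N : ℕ) : ℤ) →
        (Qcoarse L)^[k + 1] Y = 0 →
        hess (flat (d := d + 1) (n := n)) AN Y (perWin (d + 1) (L ^ (k + 1) * N)) = 0) ∧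
      ∀ (z : Site (d + 1)) (μ ν : Fin (d + 1)), ‖curlAt (flat (d := d + 1) (n := n)) AN z μ ν‖
        ≤ Fintype.card n * ((2 * (CdecD d * (((d : ℝ) + 1) * (2 * ((d : ℝ) + 1))
              * ((2 + 32 / (kappa163 (d + 1) / (d + 1)) ^ 2) * latticeConst (d + 1) (kappa163 (d + 1) / (d + 1) / 2)))))
              / ((L ^ (k + 1) : ℕ) : ℝ) * (g / ((L ^ (k + 1) : ℕ) : ℝ))
            + (((L ^ (k + 1) : ℕ) : ℝ))⁻¹ * (2 * (CdecD d * ∑ y : Tor (fun _ : Fin (d + 1) => N),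
                Real.exp (-(kappa163 (d + 1) / (d + 1) * torusSupNorm (fun _ : Fin (d + 1) => N)
                  (rep (fun _ : Fin (d + 1) => N) (B5Blocks16.blockOf (L ^ (k + 1)) (fun _ : Fin (d + 1) => N) (toT (fine (L ^ (k + 1)) (fun _ : Fin (d + 1) => N)) z))
                    - rep (fun _ : Fin (d + 1) => N) y)))
                  * (((d : ℝ) + 1) * (W y / ((L ^ (k + 1) : ℕ) : ℝ)))))) := by
  classical
  have hflatU : IsUnitaryCfg (flat (d := d + 1) (n := n)) := (flat_mem_classes (d := d + 1) (n := n) le_rfl).1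
  have hflat0 : SmallField (flat (d := d + 1) (n := n)) 0 := (flat_mem_classes (d := d + 1) (n := n) le_rfl).2
  have htow : ((tower L N (k + 1) : ℕ) : ℤ) = ((L ^ (k + 1) * N : ℕ) : ℤ) := by rw [tower_eq, Nat.mul_comm]
  have hflatPt : IsPeriodicCfg (flat (d := d + 1) (n := n)) ((tower L N (k + 1) : ℕ) : ℤ) := fun _ _ _ => rfl
  have hAPt : IsPeriodicDir A ((tower L N (k + 1) : ℕ) : ℤ) := by rw [htow]; exact hAP
  obtain ⟨-, hφP⟩ := dirIter_skew_periodic (M := N) hL k hflatU hflatPt le_rfl (levelSmall_zero L k) hflat0 hA hAPt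
  -- the split lift (F256 §2): EXACT + the split curl row
  obtain ⟨hexact, hNall⟩ := rightInverse_flat_curl_le_split (n := n) hL k N (dirIter L (k + 1) (flat (d := d + 1) (n := n)) A) φ₁ E hsplit hφP hφ₁P hg W hW
  have hNexact := hexact
  rw [← dirIter_succ_eq_cpushIter L k] at hNexact
  -- PERIODIC (F44)
  have hNP := hkLift_periodic (d := d + 1) (n := n) hL k N
    (fun p : Tor (fun _ : Fin (d + 1) => N) × Fin (d + 1) => (((L ^ (k + 1) : ℕ) : ℂ))⁻¹
      • dirIter L (k + 1) (flat (d := d + 1) (n := n)) A (B6LowerBound2153Torus.rep (fun _ : Fin (d + 1) => N) p.1) p.2)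
  -- NORTH on straight-tangent tests (F262)
  have hNorth : ∀ Y : Site (d + 1) → Fin (d + 1) → Matrix n n ℂ, IsSkewDir Y → IsPeriodicDir Y ((L ^ (k + 1) * N : ℕ) : ℤ) →
      (Qcoarse L)^[k + 1] Y = 0 → _ :=
    fun Y hY hYP hYQ => hess_flat_hkLift_eq_zero_straight (d := d + 1) (n := n) k
      (fun p : Tor (fun _ : Fin (d + 1) => N) × Fin (d + 1) => (((L ^ (k + 1) : ℕ) : ℂ))⁻¹
        • dirIter L (k + 1) (flat (d := d + 1) (n := n)) A (B6LowerBound2153Torus.rep (fun _ : Fin (d + 1) => N) p.1) p.2) hY hYP hYQ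
  -- the skew part keeps the letters (p2's R1b), the curl bound pointwise
  refine ⟨skewPart _, isSkewDir_skewPart _, isPeriodicDir_skewPart hNP, ?_, fun Y hY hYP hYQ => ?_, fun z μ ν => ?_⟩
  · rw [dirIter_flat_skewPart hL, hNexact, skewPart_eq_self (isSkewDir_dirIter_flat hL (k + 1) hA)]
  · rw [hess_flat_skewPart _ hY]
    exact hNorth Y hY hYP hYQ
  · exact (norm_curlAt_flat_skewPart_le _ z μ ν).trans (hNall z μ ν)


/-! ## §2 THE v4 END -/

/-- **`hape` ⇐ THE PER-PLAQUETTE BUNDLE OF THE TORUS ROAD v4** (dimension `d + 1`, `L ≥ 1`; statement in the module docstring §2): v3's bundle with the two-region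
criticality defect hypothesised on STRAIGHT-TANGENT tests only (`(Qcoarse L)^[k+1] Y = 0`) and far threshold `ℓ`. [cite: Balaban1985Variational, Prop. 8 p.304] -/
theorem hape_of_torusRoadV4 [Nonempty n] {L : ℕ} [NeZero L] (hL : 1 ≤ L) :
    ∃ K c : ℝ, 0 ≤ K ∧ 0 < c ∧ ∀ (N : ℕ) [NeZero N] (ε δ δ₁ β c₀ θ : ℝ), 0 ≤ c₀ → 0 ≤ θ → θ < 1 → c₀ + θ * δ ≤ δ → c₀ / (1 - θ) < δ₁ →
    (∀ D : Site (d + 1) → Fin (d + 1) → (Matrix n n ℂ)ˣ, IsUnitaryCfg D → IsPeriodicCfg D (N : ℤ) → SmallField D (4 * (Real.exp β - 1)) →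
      ∀ (k : ℕ), ∀ U ∈ admissible (sfClass (d + 1) L N ε) L (k + 1) D,
      (∀ φ : Site (d + 1) → Fin (d + 1) → Matrix n n ℂ, IsSkewDir φ → IsPeriodicDir φ ((N * L ^ (k + 1) : ℕ) : ℤ) → TangentIter L k U φ →
        dAction U φ (perWin (d + 1) (N * L ^ (k + 1))) = 0) →
      ∀ r : ℝ, 0 ≤ r → r ≤ δ → SmallField U (r / ((L : ℝ) ^ (k + 1)) ^ 2) →
      ∀ (z : Site (d + 1)) (μ ν : Fin (d + 1)), μ ≠ ν →
        ∃ (A φ₁ E : Site (d + 1) → Fin (d + 1) → Matrix n n ℂ) (α₀ α₁ τn τf g s ℓ : ℝ) (u : Site (d + 1) → (Matrix n n ℂ)ˣ),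
          -- the chart, cut off ((N1)-weak + cutoff)
          (IsSkewDir A ∧ IsPeriodicDir A ((N * L ^ (k + 1) : ℕ) : ℤ) ∧ 0 ≤ α₀ ∧ 0 ≤ α₁ ∧ (∀ y κ, ‖A y κ‖ ≤ α₀) ∧
            (∀ (y : Site (d + 1)) (κ τ' : Fin (d + 1)), ‖A (y + e τ') κ - A y κ‖ ≤ α₁)) ∧
          -- the SPLIT of its linearised top average: near datum `φ₁` (coarse curl `ĝ`), far remainder `E` (size `s`, zero within `ℓ` blocks of the plaquette's block)
          (dirIter L (k + 1) (flat (d := d + 1) (n := n)) A = φ₁ + E ∧ IsPeriodicDir φ₁ (N : ℤ) ∧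
            (∀ (y : Site (d + 1)) (μ' ν' : Fin (d + 1)), ‖curlAt (flat (d := d + 1) (n := n)) φ₁ y μ' ν'‖ ≤ g) ∧ 0 ≤ s ∧
            (∀ (y : Tor (fun _ : Fin (d + 1) => N)) (lam : Fin (d + 1)), ‖E (rep (fun _ : Fin (d + 1) => N) y) lam‖ ≤ s) ∧
            (∀ (y : Tor (fun _ : Fin (d + 1) => N)), torusSupNorm (fun _ : Fin (d + 1) => N) (rep (fun _ : Fin (d + 1) => N) y
                - rep (fun _ : Fin (d + 1) => N) (B5Blocks16.blockOf (L ^ (k + 1)) (fun _ : Fin (d + 1) => N)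
                            (toT (fine (L ^ (k + 1)) (fun _ : Fin (d + 1) => N)) z))) < ℓ →
              ∀ lam : Fin (d + 1), E (rep (fun _ : Fin (d + 1) => N) y) lam = 0)) ∧
          -- the two-region criticality defect ON STRAIGHT-TANGENT TESTS ((N2)), far threshold `ℓ`
          (0 ≤ τn ∧ 0 ≤ τf ∧ ∀ Y : Site (d + 1) → Fin (d + 1) → Matrix n n ℂ, IsSkewDir Y → IsPeriodicDir Y ((N * L ^ (k + 1) : ℕ) : ℤ) →
            (Qcoarse L)^[k + 1] Y = 0 →
            |dAction (vary (flat (d := d + 1) (n := n)) A 1) Y (perWin (d + 1) (N * L ^ (k + 1)))|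
              ≤ τn * dirL1 Y ((periodBox (d := d + 1) (N * L ^ (k + 1))).filter (fun x => ¬ (ℓ
                    ≤ torusSupNorm (fun _ : Fin (d + 1) => N) ((fun i => x i / ((L ^ (k + 1) : ℕ) : ℤ))
                        - rep (fun _ : Fin (d + 1) => N) (B5Blocks16.blockOf (L ^ (k + 1)) (fun _ : Fin (d + 1) => N)
                            (toT (fine (L ^ (k + 1)) (fun _ : Fin (d + 1) => N)) z))))))
                + τf * dirL1 Y ((periodBox (d := d + 1) (N * L ^ (k + 1))).filter (fun x => ℓ
                    ≤ torusSupNorm (fun _ : Fin (d + 1) => N) ((fun i => x i / ((L ^ (k + 1) : ℕ) : ℤ))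
                        - rep (fun _ : Fin (d + 1) => N) (B5Blocks16.blockOf (L ^ (k + 1)) (fun _ : Fin (d + 1) => N)
                            (toT (fine (L ^ (k + 1)) (fun _ : Fin (d + 1) => N)) z)))))) ∧
          -- the gauge matching `U` to `e^{A}` on the four bonds of the plaquette
          (IsUnitarySite u ∧ gaugeAct u U z μ = vary (flat (d := d + 1) (n := n)) A 1 z μ ∧
            gaugeAct u U (z + e μ) ν = vary (flat (d := d + 1) (n := n)) A 1 (z + e μ) ν ∧
            gaugeAct u U (z + e ν) μ = vary (flat (d := d + 1) (n := n)) A 1 (z + e ν) μ ∧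
            gaugeAct u U z ν = vary (flat (d := d + 1) (n := n)) A 1 z ν) ∧
          -- the numeric line
          K * (L : ℝ) ^ (k + 1) * ((τn + ((Fintype.card (T4AveragingDeficitWall.Plane (d + 1)) : ℝ)
              * (2 * (8 * α₀ * (2 * α₁ + 28 * α₀ ^ 2) + 6 * (Real.exp α₀ - 1) * (2 * α₁ + 24 * (Real.exp α₀ - 1) * α₀)
                  + (2 * α₁ + 24 * (Real.exp α₀ - 1) * α₀) * (2 * α₁ + 28 * α₀ ^ 2) + 960 * (Real.exp α₀ - 1) * α₀ ^ 2)
                + 64 * α₀ * α₁)))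
              + Real.exp (-(c * ℓ)) * (τf + ((Fintype.card (T4AveragingDeficitWall.Plane (d + 1)) : ℝ)
              * (2 * (8 * α₀ * (2 * α₁ + 28 * α₀ ^ 2) + 6 * (Real.exp α₀ - 1) * (2 * α₁ + 24 * (Real.exp α₀ - 1) * α₀)
                  + (2 * α₁ + 24 * (Real.exp α₀ - 1) * α₀) * (2 * α₁ + 28 * α₀ ^ 2) + 960 * (Real.exp α₀ - 1) * α₀ ^ 2)
                + 64 * α₀ * α₁))))
            + Fintype.card n * ((2 * (CdecD d * (((d : ℝ) + 1) * (2 * ((d : ℝ) + 1))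
              * ((2 + 32 / (kappa163 (d + 1) / (d + 1)) ^ 2) * latticeConst (d + 1) (kappa163 (d + 1) / (d + 1) / 2)))))
                / ((L ^ (k + 1) : ℕ) : ℝ) * (g / ((L ^ (k + 1) : ℕ) : ℝ))
              + (((L ^ (k + 1) : ℕ) : ℝ))⁻¹ * (2 * (CdecD d * ((((d : ℝ) + 1) / ((L ^ (k + 1) : ℕ) : ℝ))
                * (s * latticeConst (d + 1) (kappa163 (d + 1) / (d + 1) / 2) * Real.exp (-(kappa163 (d + 1) / (d + 1) / 2 * ℓ)))))))
            + 28 * α₀ ^ 2 ≤ (c₀ + θ * r) / ((L : ℝ) ^ (k + 1)) ^ 2) →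
    ∀ D : Site (d + 1) → Fin (d + 1) → (Matrix n n ℂ)ˣ, IsUnitaryCfg D → IsPeriodicCfg D (N : ℤ) → SmallField D (4 * (Real.exp β - 1)) →
      ∀ (k : ℕ), ∀ U ∈ admissible (sfClass (d + 1) L N ε) L (k + 1) D, SmallField U (δ / ((L : ℝ) ^ (k + 1)) ^ 2) →
      (∀ φ : Site (d + 1) → Fin (d + 1) → Matrix n n ℂ, IsSkewDir φ → IsPeriodicDir φ ((N * L ^ (k + 1) : ℕ) : ℤ) → TangentIter L k U φ →
        dAction U φ (perWin (d + 1) (N * L ^ (k + 1))) = 0) → SmallField U (δ₁ / ((L : ℝ) ^ (k + 1)) ^ 2) := by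
  classical
  obtain ⟨K, c, hK, hc, hG⟩ := sliceGreen_flat_localised_straight (n := n) (d := d) hL
  refine ⟨K, c, hK, hc, ?_⟩
  intro N _ ε δ δ₁ β c₀ θ hc₀ hθ0 hθ1 hcδ hδ₁ hloc D hDu hDP hDs k U hU hUδ hcrit
  have hL1 : 1 ≤ L := hL
  have hLpos : (0 : ℝ) < L := by exact_mod_cast (by omega : 0 < L)
  have hS : 0 < ((L : ℝ) ^ (k + 1)) ^ 2 := by positivity
  have hmc : N * L ^ (k + 1) = L ^ (k + 1) * N := Nat.mul_comm _ _
  have hP1 : 1 ≤ N * L ^ (k + 1) := Nat.one_le_iff_ne_zero.mpr (Nat.mul_ne_zero (NeZero.ne N) (pow_ne_zero _ (by omega)))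
  have hMpos : (0 : ℝ) < ((L ^ (k + 1) : ℕ) : ℝ) := by positivity
  have hflatU : IsUnitaryCfg (flat (d := d + 1) (n := n)) := (flat_mem_classes (d := d + 1) (n := n) le_rfl).1
  have hflat0 : SmallField (flat (d := d + 1) (n := n)) 0 := (flat_mem_classes (d := d + 1) (n := n) le_rfl).2
  have hκ2 : 0 < kappa163 (d + 1) / (d + 1) / 2 := by have := kappa163_pos (d + 1); positivity
  -- the affine improvement at this configuration, plaquette by plaquette
  have himp : ∀ r : ℝ, 0 ≤ r → r ≤ δ → SmallField U (r / ((L : ℝ) ^ (k + 1)) ^ 2) →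
      SmallField U ((c₀ + θ * r) / ((L : ℝ) ^ (k + 1)) ^ 2) := by
    intro r hr0 hrδ hUr z μ ν hμν
    obtain ⟨A, φ₁, E, α₀, α₁, τn, τf, g, s, ℓ, u, ⟨hA, hAP, hα₀, hα₁, hAα, hA1⟩, ⟨hsplit, hφ₁P, hg, hs0, hEs, hE0⟩, ⟨hτn, hτf, hcritD⟩,
      ⟨hu, h1, h2, h3, h4⟩, hnum⟩ := hloc D hDu hDP hDs k U hU hcrit r hr0 hrδ hUr z μ ν hμν
    -- EXP's global density `ρ(α₀, α₁)` (F48b), abbreviated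
    set ρx : ℝ := ((Fintype.card (T4AveragingDeficitWall.Plane (d + 1)) : ℝ)
              * (2 * (8 * α₀ * (2 * α₁ + 28 * α₀ ^ 2) + 6 * (Real.exp α₀ - 1) * (2 * α₁ + 24 * (Real.exp α₀ - 1) * α₀)
                  + (2 * α₁ + 24 * (Real.exp α₀ - 1) * α₀) * (2 * α₁ + 28 * α₀ ^ 2) + 960 * (Real.exp α₀ - 1) * α₀ ^ 2)
                + 64 * α₀ * α₁)) with hρx
    have hδe : 0 ≤ Real.exp α₀ - 1 := by linarith [Real.add_one_le_exp α₀]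
    have hρ0 : 0 ≤ ρx := by rw [hρx]; positivity
    -- the plaquette's block and the two regions
    set y₀ : Tor (fun _ : Fin (d + 1) => N) :=
      B5Blocks16.blockOf (L ^ (k + 1)) (fun _ : Fin (d + 1) => N) (toT (fine (L ^ (k + 1)) (fun _ : Fin (d + 1) => N)) z) with hy₀
    set Bf : Finset (Site (d + 1)) := (periodBox (d := d + 1) (N * L ^ (k + 1))).filter (fun x => ℓ
        ≤ torusSupNorm (fun _ : Fin (d + 1) => N) ((fun i => x i / ((L ^ (k + 1) : ℕ) : ℤ)) - rep (fun _ : Fin (d + 1) => N) y₀)) with hBf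
    set Bn : Finset (Site (d + 1)) := (periodBox (d := d + 1) (N * L ^ (k + 1))).filter (fun x => ¬ (ℓ
        ≤ torusSupNorm (fun _ : Fin (d + 1) => N) ((fun i => x i / ((L ^ (k + 1) : ℕ) : ℤ)) - rep (fun _ : Fin (d + 1) => N) y₀))) with hBn
    have hcover : periodBox (d := d + 1) (N * L ^ (k + 1)) ⊆ Bn ∪ Bf := by
      intro x hx
      rw [Finset.mem_union, hBn, hBf, Finset.mem_filter, Finset.mem_filter]
      by_cases h : ℓ
          ≤ torusSupNorm (fun _ : Fin (d + 1) => N) ((fun i => x i / ((L ^ (k + 1) : ℕ) : ℤ)) - rep (fun _ : Fin (d + 1) => N) y₀)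
      · exact Or.inr ⟨hx, h⟩
      · exact Or.inl ⟨hx, h⟩
    have hBnP : Bn ⊆ periodBox (d := d + 1) (L ^ (k + 1) * N) := by rw [← hmc]; exact Finset.filter_subset _ _
    have hBfP : Bf ⊆ periodBox (d := d + 1) (L ^ (k + 1) * N) := by rw [← hmc]; exact Finset.filter_subset _ _
    have hBffar : ∀ x ∈ Bf, ℓ
        ≤ torusSupNorm (fun _ : Fin (d + 1) => N) ((fun i => x i / ((L ^ (k + 1) : ℕ) : ℤ)) - rep (fun _ : Fin (d + 1) => N) y₀) :=
      fun x hx => (Finset.mem_filter.mp hx).2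
    -- G♭-loc on straight tests at this plaquette (F261), period spelled `N·L^{k+1}`
    have hGloc : ∀ X : Site (d + 1) → Fin (d + 1) → Matrix n n ℂ, X ∈ (Set.univ : Set (Site (d + 1) → Fin (d + 1) → Matrix n n ℂ)) → IsSkewDir X →
        IsPeriodicDir X ((N * L ^ (k + 1) : ℕ) : ℤ) → dirIter L (k + 1) (flat (d := d + 1) (n := n)) X = 0 → ∀ a b : ℝ, 0 ≤ a → 0 ≤ b →
        (∀ Y : Site (d + 1) → Fin (d + 1) → Matrix n n ℂ, IsSkewDir Y → IsPeriodicDir Y ((N * L ^ (k + 1) : ℕ) : ℤ) →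
          (Qcoarse L)^[k + 1] Y = 0 →
          |hess (flat (d := d + 1) (n := n)) X Y (perWin (d + 1) (N * L ^ (k + 1)))| ≤ a * dirL1 Y Bn + b * dirL1 Y Bf) →
        ‖curlAt (flat (d := d + 1) (n := n)) X z μ ν‖ ≤ K * (L : ℝ) ^ (k + 1) * (a + Real.exp (-(c * ℓ)) * b) := by
      intro X _ hXs hXP hXT a b ha hb hsrc
      rw [hmc] at hXP hsrc
      exact hG k N y₀ ℓ X hXs hXP hXT Bn Bf hBnP hBfP hBffar a b ha hb hsrc z rfl μ ν
    -- the split normal part (§1), period spelled `N·L^{k+1}`; weight `W = s·[far]`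
    have hAP' : IsPeriodicDir A ((L ^ (k + 1) * N : ℕ) : ℤ) := by rw [← hmc]; exact hAP
    set W : Tor (fun _ : Fin (d + 1) => N) → ℝ := fun y =>
      if torusSupNorm (fun _ : Fin (d + 1) => N) (rep (fun _ : Fin (d + 1) => N) y - rep (fun _ : Fin (d + 1) => N) y₀) < ℓ then 0 else s with hWdef
    have hW : ∀ (y : Tor (fun _ : Fin (d + 1) => N)) (lam : Fin (d + 1)), ‖E (rep (fun _ : Fin (d + 1) => N) y) lam‖ ≤ W y := by
      intro y lam
      simp only [hWdef]
      split_ifs with hnear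
      · rw [hE0 y hnear lam, norm_zero]
      · exact hEs y lam
    have hWs : ∀ y, W y ≤ s := fun y => by simp only [hWdef]; split_ifs <;> linarith
    have hWnear : ∀ y, torusSupNorm (fun _ : Fin (d + 1) => N) (rep (fun _ : Fin (d + 1) => N) y - rep (fun _ : Fin (d + 1) => N) y₀) < ℓ → W y ≤ 0 :=
      fun y hy => by simp only [hWdef]; rw [if_pos hy]
    obtain ⟨AN, hNs, hNP, hNexact, hNorth, hNcurl⟩ := exists_flat_normalPart_split_straight (n := n) hL1 k N hA hAP' φ₁ E hsplit hφ₁P hg W hW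
    have hNP' : IsPeriodicDir AN ((N * L ^ (k + 1) : ℕ) : ℤ) := by rw [hmc]; exact hNP
    have hNorth' : ∀ Y : Site (d + 1) → Fin (d + 1) → Matrix n n ℂ, IsSkewDir Y → IsPeriodicDir Y ((N * L ^ (k + 1) : ℕ) : ℤ) →
        (Qcoarse L)^[k + 1] Y = 0 →
        hess (flat (d := d + 1) (n := n)) AN Y (perWin (d + 1) (N * L ^ (k + 1))) = 0 := by
      intro Y hY hYP hYQ
      rw [hmc] at hYP ⊢
      exact hNorth Y hY hYP hYQ
    -- the far weight is discounted (F256 §3)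
    have hfarsum := sum_exp_far_weight_le (d := d) (fun _ : Fin (d + 1) => N) y₀ W hs0 hWs hWnear
    -- EXP (F48b) entered in both regions through `periodBox ⊆ Bn ∪ Bf`
    have hEXP2 : ∀ Y : Site (d + 1) → Fin (d + 1) → Matrix n n ℂ, IsSkewDir Y → IsPeriodicDir Y ((N * L ^ (k + 1) : ℕ) : ℤ) →
        |dAction (vary (flat (d := d + 1) (n := n)) A 1) Y (perWin (d + 1) (N * L ^ (k + 1)))
            - hess (flat (d := d + 1) (n := n)) A Y (perWin (d + 1) (N * L ^ (k + 1)))| ≤ ρx * dirL1 Y Bn + ρx * dirL1 Y Bf := by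
      intro Y hY hYP
      have h := abs_dAction_vary_sub_hess_flat_le hP1 hA hAP hα₀ hα₁ hAα hA1 hY hYP
      rw [← hρx] at h
      have hcov := dirL1_le_add_of_subset_union Y hcover
      have hmul : ρx * dirL1 Y (periodBox (d := d + 1) (N * L ^ (k + 1))) ≤ ρx * (dirL1 Y Bn + dirL1 Y Bf) :=
        mul_le_mul_of_nonneg_left hcov hρ0
      linarith
    -- F260 §2 at this plaquette, test class `(Qcoarse L)^[k+1] · = 0`, `S := univ`
    have hplaq := norm_plaq_sub_one_le_of_localisedLetters_gauge_test (d := d + 1) (n := n) hL1 k hflatU hflat0 le_rfl (levelSmall_zero L k) hflat0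
      (fun Y : Site (d + 1) → Fin (d + 1) → Matrix n n ℂ => (Qcoarse L)^[k + 1] Y = 0)
      hA hAP hAα hNs hNP' hNexact hNorth' Set.univ (Set.mem_univ _) Bn Bf z hμν hGloc hρ0 hρ0 hEXP2 hτn hτf hcritD hu h1 h2 h3 h4
    -- the normal curl at the plaquette: split row (§1) + the far discount
    have hcurlN := hNcurl z μ ν
    have hsumW : ∑ y : Tor (fun _ : Fin (d + 1) => N),
        Real.exp (-(kappa163 (d + 1) / (d + 1) * torusSupNorm (fun _ : Fin (d + 1) => N)
          (rep (fun _ : Fin (d + 1) => N) y₀ - rep (fun _ : Fin (d + 1) => N) y))) * (((d : ℝ) + 1) * (W y / ((L ^ (k + 1) : ℕ) : ℝ)))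
        ≤ (((d : ℝ) + 1) / ((L ^ (k + 1) : ℕ) : ℝ))
          * (s * latticeConst (d + 1) (kappa163 (d + 1) / (d + 1) / 2) * Real.exp (-(kappa163 (d + 1) / (d + 1) / 2 * ℓ))) := by
      have e : ∑ y : Tor (fun _ : Fin (d + 1) => N),
          Real.exp (-(kappa163 (d + 1) / (d + 1) * torusSupNorm (fun _ : Fin (d + 1) => N)
            (rep (fun _ : Fin (d + 1) => N) y₀ - rep (fun _ : Fin (d + 1) => N) y))) * (((d : ℝ) + 1) * (W y / ((L ^ (k + 1) : ℕ) : ℝ)))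
          = (((d : ℝ) + 1) / ((L ^ (k + 1) : ℕ) : ℝ)) * ∑ y : Tor (fun _ : Fin (d + 1) => N),
            Real.exp (-(kappa163 (d + 1) / (d + 1) * torusSupNorm (fun _ : Fin (d + 1) => N)
              (rep (fun _ : Fin (d + 1) => N) y₀ - rep (fun _ : Fin (d + 1) => N) y))) * W y := by
        rw [Finset.mul_sum]
        refine Finset.sum_congr rfl fun y _ => ?_
        field_simp
      rw [e]
      exact mul_le_mul_of_nonneg_left hfarsum (by positivity)
    have hcurlN' : ‖curlAt (flat (d := d + 1) (n := n)) AN z μ ν‖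
        ≤ Fintype.card n * ((2 * (CdecD d * (((d : ℝ) + 1) * (2 * ((d : ℝ) + 1))
              * ((2 + 32 / (kappa163 (d + 1) / (d + 1)) ^ 2) * latticeConst (d + 1) (kappa163 (d + 1) / (d + 1) / 2)))))
            / ((L ^ (k + 1) : ℕ) : ℝ) * (g / ((L ^ (k + 1) : ℕ) : ℝ))
          + (((L ^ (k + 1) : ℕ) : ℝ))⁻¹ * (2 * (CdecD d * ((((d : ℝ) + 1) / ((L ^ (k + 1) : ℕ) : ℝ))
            * (s * latticeConst (d + 1) (kappa163 (d + 1) / (d + 1) / 2) * Real.exp (-(kappa163 (d + 1) / (d + 1) / 2 * ℓ))))))) := by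
      refine hcurlN.trans (mul_le_mul_of_nonneg_left (add_le_add le_rfl (mul_le_mul_of_nonneg_left
        (mul_le_mul_of_nonneg_left (mul_le_mul_of_nonneg_left hsumW CdecD_nonneg) (by norm_num)) (by positivity))) (by positivity))
    exact hplaq.trans (by linarith)
  exact smallField_floor_of_affineImprovement hS hc₀ hθ0 hθ1 hcδ hδ₁ himp hUδ

end

end Summit.QuantumFields.BalabanUV.T4Continuum.NE7ApeOfTorusRoadV4
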